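import Summits.BirchSwinnertonDyer.BirchSwinnertonDyer.Theorems.KatoDescentPotSupersingularKatoFiniteLevelStrictAdditiveTamagawa
import Summits.BirchSwinnertonDyer.Rank1Residual.GaloisImage.InertiaRootableNonsplitMultiplicative
import Summits.BirchSwinnertonDyer.Rank1Residual.GaloisImage.InertiaDivisibleMultiplicativeLocal
import Summits.BirchSwinnertonDyer.Rank1Residual.GaloisImage.UnramifiedPrimaryVanishingOfDivisible
import Literature.NumberTheory.EllipticCurves.NeronComponentIndexSplitProofs
import Literature.NumberTheory.EllipticCurves.TamagawaSubgroupProofs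
import HarnessLib

/-!
# Kato's (14.9.3) at finite level, part 24: the Néron / Tamagawa reading `#H¹_ur(K_v, E[p^∞]) = p^{v_p(c_v)}` at EVERY finite
# place `v ∤ p` (`p` odd) except the split multiplicative places with `p ∣ ord_v Δ_min`
# (route `KatoDescentPotSupersingular` / `…Tame…`, crux M = stmt-BirchSwinnertonDyer-19196; route-free helper)

Seat `bsd-potss-rkm` g18 (prover; cell `bsd-potss`), item stmt-BirchSwinnertonDyer-19196 (`--supports … --as helper`; closes
nothing).  HONEST FRAMING: BSD is not proved by any of this; nothing is booked; theorems only (no definition, no named fact).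

Item (δ) of the rkm g17 successor menu (the Tamagawa term of Kato's Prop. 14.16 (2) / §14.8, «`#H¹_ur(ℚ_ℓ, E[p^∞]) = c_ℓ^{(p)}`»),
assembled place by place from the tree (part 23 for the additive places; n1011's `InertiaDivisible` files and the X11b
good-place vanishing for the others) against the tree's Tamagawa theorems (Tate's algorithm / Kodaira–Néron):

| place `v ∤ p` | `H¹_ur(K_v, E[p^∞])` | `c_v` | source |
|---|---|---|---|
| good | `0` (`X11b.LocBridge.unramifiedSubgroup_primary_eq_bot`) | `1` (`localTamagawaNumber_eq_one_of_hasGoodReductionAt_holds`) | — |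
| non-split multiplicative (`p` odd) | `0` (`InertiaDivisible.unramifiedSubgroup_primary_eq_bot_of_nonsplit`) | `∣ 2` (`localTamagawaNumber_dvd_two_of_nonsplit`) | Tate Step 2 |
| split multiplicative, `p ∤ ord_v Δ` | `0` (`…_of_inertiaDivisible` + `inertiaDivisible_of_hasMultiplicativeReductionAt`) | `ord_v Δ_min` (`localTamagawaNumber_eq_ordMinimalDiscriminant_…`) | *ATAEC* IV.9.2(d) |
| additive | `#E(K_v)[p^∞] = p^{v_p(c_v)}` (part 23) | — | part 23 |
| split multiplicative, `p ∣ ord_v Δ` | `p^{v_p(ord_v Δ)}` — NOT in the tree | `ord_v Δ_min` | open |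

* `natCard_unramifiedSubgroup_primary_eq_one_of_hasGoodReductionAt`, `…_of_nonsplit`, `…_of_split_of_not_dvd` — the three
  vanishing rows as `Nat.card … = 1 = p ^ v_p(c_v)`;
* **`natCard_unramifiedSubgroup_primary_eq_pow_padicValNat_localTamagawaNumber`** — for `E/K` elliptic over a number field,
  `p` an ODD prime, `v ∤ p` ANY finite place which is not split multiplicative with `p ∣ ord_v Δ_min`:
  **`#H¹_ur(K_v, E[p^∞]) = p^{v_p(c_v)}`**.

References: K. Kato, Astérisque 295 (2004) §14.8 (p. 238), Prop. 14.16 (2) [Kato2004Asterisque]; R. Greenberg, LNM 1716 (1999) §3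
Lemma 3.3, §4 proof of Thm. 4.1 (p. 74) [GreenbergLNM1716]; J. H. Silverman, *ATAEC* IV.9 (Tate's algorithm), Cor. IV.9.2(d)
[SilvermanATAEC1994]; J. S. Milne, *ADT* I Prop. 3.8 [MilneADT2006].
-/

-- the summit and its single problem are both named `BirchSwinnertonDyer` (registry layout D-0017)
set_option linter.dupNamespace false
set_option autoImplicit false

noncomputable section

open scoped Classical NumberField
open Function Field NumberField IsDedekindDomain IsDedekindDomain.HeightOneSpectrum WeierstrassCurve
open Literature.NumberTheory.EllipticCurves Literature.NumberTheory.GaloisRepresentations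
  Literature.NumberTheory.GaloisRepresentations.DiscreteGaloisModule Literature.NumberTheory.GaloisCohomology
open Summit.BirchSwinnertonDyer.Rank1Residual.X11b.LocBridge
open Summit.BirchSwinnertonDyer.Rank1Residual.GaloisImage

namespace Summit.BirchSwinnertonDyer.BirchSwinnertonDyer.Theorems.KatoFiniteLevelCount

section Places

variable {K : Type} [Field K] [NumberField K] (W : WeierstrassCurve K) [W.IsElliptic] (p : ℕ) [Fact p.Prime]
  (v : HeightOneSpectrum (𝓞 K))

/-- **Good places `v ∤ p`: `#H¹_ur(K_v, E[p^∞]) = 1 = p^{v_p(c_v)}`** (`H¹_ur = 0` for the unramified divisible module `E[p^∞]`,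
X11b `unramifiedSubgroup_primary_eq_bot`; `c_v = 1`, Tate's algorithm Step 1).
[cite: MilneADT2006, Ch. I Lemma 2.9 and Prop. 3.8] [cite: SilvermanATAEC1994, IV.9, Tate's algorithm 9.4, Step 1] -/
theorem natCard_unramifiedSubgroup_primary_eq_pow_of_hasGoodReductionAt
    (hpv : (p : 𝓞 K) ∉ v.asIdeal) (hgood : W.HasGoodReductionAt v) :
    Nat.card (unramifiedSubgroup (GaloisRep.toLocal v (primaryGaloisModule W p)) 1) =
      p ^ padicValNat p ((W.baseChange (v.adicCompletion K)).localTamagawaNumber (v.adicCompletionIntegers K)) := by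
  have h0 : DiscreteGaloisModule.unramifiedSubgroup
      (GaloisRep.restrictField (v.adicCompletion K) (primaryGaloisModule W p)) 1 = ⊥ :=
    unramifiedSubgroup_primary_eq_bot W p hpv hgood
  rw [W.localTamagawaNumber_eq_one_of_hasGoodReductionAt_holds v hgood, padicValNat_one_right, pow_zero]
  change Nat.card (DiscreteGaloisModule.unramifiedSubgroup
    (GaloisRep.restrictField (v.adicCompletion K) (primaryGaloisModule W p)) 1) = 1
  rw [h0]
  exact Nat.card_unique

/-- **Non-split multiplicative places `v ∤ p`, `p` odd: `#H¹_ur(K_v, E[p^∞]) = 1 = p^{v_p(c_v)}`** (`H¹_ur = 0` by n1011's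
`unramifiedSubgroup_primary_eq_bot_of_nonsplit`; `c_v ∣ 2` by Tate's algorithm Step 2, so `v_p(c_v) = 0` for odd `p`).
[cite: SilvermanATAEC1994, IV.9.4 Step 2 (PDF p. 344)] [cite: GreenbergLNM1716, §3 Lemma 3.3] -/
theorem natCard_unramifiedSubgroup_primary_eq_pow_of_nonsplit
    (hpv : (p : 𝓞 K) ∉ v.asIdeal) (hp2 : p ≠ 2)
    (hmult : W.HasMultiplicativeReductionAt v) (hns : ¬ W.HasSplitMultiplicativeReductionAt v) :
    Nat.card (unramifiedSubgroup (GaloisRep.toLocal v (primaryGaloisModule W p)) 1) =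
      p ^ padicValNat p ((W.baseChange (v.adicCompletion K)).localTamagawaNumber (v.adicCompletionIntegers K)) := by
  have hp : p.Prime := Fact.out
  have h0 := InertiaDivisible.unramifiedSubgroup_primary_eq_bot_of_nonsplit W p hpv hp2 hmult hns
  have hc := InertiaDivisible.localTamagawaNumber_dvd_two_of_nonsplit W hmult hns
  -- `v_p(c_v) = 0`: `c_v ∣ 2` and `p` is an odd prime
  have hval : padicValNat p ((W.baseChange (v.adicCompletion K)).localTamagawaNumber (v.adicCompletionIntegers K)) = 0 := by
    refine padicValNat.eq_zero_of_not_dvd fun hdvd => ?_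
    have h2 : p ∣ 2 := dvd_trans hdvd hc
    have hle : p ≤ 2 := Nat.le_of_dvd two_pos h2
    have hge : 2 ≤ p := hp.two_le
    exact hp2 (le_antisymm hle hge)
  rw [hval, pow_zero]
  change Nat.card (DiscreteGaloisModule.unramifiedSubgroup
    (GaloisRep.restrictField (v.adicCompletion K) (primaryGaloisModule W p)) 1) = 1
  rw [h0]
  exact Nat.card_unique

/-- **Split multiplicative places `v ∤ p` with `p ∤ ord_v Δ_min`: `#H¹_ur(K_v, E[p^∞]) = 1 = p^{v_p(c_v)}`** (`E[p^∞]^{I_v}` is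
`p`-divisible, n1011's `inertiaDivisible_of_hasMultiplicativeReductionAt`, so `H¹_ur = 0`,
`unramifiedSubgroup_primary_eq_bot_of_inertiaDivisible`; `c_v = ord_v Δ_min`, *ATAEC* Cor. IV.9.2(d)).
[cite: SilvermanATAEC1994, Cor. IV.9.2(d) (PDF p. 340) and Thm. IV.10.2(a)] [cite: GreenbergLNM1716, §3 Lemma 3.3] -/
theorem natCard_unramifiedSubgroup_primary_eq_pow_of_split_of_not_dvd
    (hpv : (p : 𝓞 K) ∉ v.asIdeal) (hsplit : W.HasSplitMultiplicativeReductionAt v)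
    (hnd : ¬ p ∣ W.ordMinimalDiscriminant v) :
    Nat.card (unramifiedSubgroup (GaloisRep.toLocal v (primaryGaloisModule W p)) 1) =
      p ^ padicValNat p ((W.baseChange (v.adicCompletion K)).localTamagawaNumber (v.adicCompletionIntegers K)) := by
  have hmult : W.HasMultiplicativeReductionAt v := hsplit.toHasMultiplicativeReduction
  have h0 := InertiaDivisible.unramifiedSubgroup_primary_eq_bot_of_inertiaDivisible W p hpv
    (fun t ht => InertiaDivisible.inertiaDivisible_of_hasMultiplicativeReductionAt W (ℓ := p) hpv hmult hnd t ht)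
  rw [localTamagawaNumber_eq_ordMinimalDiscriminant_of_hasSplitMultiplicativeReductionAt v W hsplit,
    padicValNat.eq_zero_of_not_dvd hnd, pow_zero]
  change Nat.card (DiscreteGaloisModule.unramifiedSubgroup
    (GaloisRep.restrictField (v.adicCompletion K) (primaryGaloisModule W p)) 1) = 1
  rw [h0]
  exact Nat.card_unique

/-- **The Néron / Tamagawa reading at every finite place `v ∤ p` (`p` odd) that is not split multiplicative with
`p ∣ ord_v Δ_min`: `#H¹_ur(K_v, E[p^∞]) = p^{v_p(c_v)}`** — good, non-split multiplicative, split multiplicative with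
`p ∤ ord_v Δ`, additive (part 23); the order of Kato's §14.8 summand `H¹(𝔽_v, H⁰(K_v^{nr}, E[p^∞]))` is the `p`-part of the
Tamagawa number.  The excluded case (`H¹_ur` of order `p^{v_p(ord_v Δ)}`, Tate curve) is not in the tree.
[cite: Kato2004Asterisque, §14.8 (p. 238)] [cite: GreenbergLNM1716, §3 Lemma 3.3 and §4 proof of Thm. 4.1 (p. 74)]
[cite: SilvermanATAEC1994, IV.9 (Tate's algorithm) and Cor. IV.9.2(d)] -/
theorem natCard_unramifiedSubgroup_primary_eq_pow_padicValNat_localTamagawaNumber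
    (hpv : (p : 𝓞 K) ∉ v.asIdeal) (hp2 : p ≠ 2)
    (hexc : W.HasSplitMultiplicativeReductionAt v → ¬ p ∣ W.ordMinimalDiscriminant v) :
    Nat.card (unramifiedSubgroup (GaloisRep.toLocal v (primaryGaloisModule W p)) 1) =
      p ^ padicValNat p ((W.baseChange (v.adicCompletion K)).localTamagawaNumber (v.adicCompletionIntegers K)) := by
  rcases hasGoodReduction_or_hasMultiplicativeReduction_or_hasAdditiveReduction
      (R := v.adicCompletionIntegers K) (W := W.localMinimalModel v) with hg | hm | ha
  · exact natCard_unramifiedSubgroup_primary_eq_pow_of_hasGoodReductionAt W p v hpv hg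
  · by_cases hs : W.HasSplitMultiplicativeReductionAt v
    · exact natCard_unramifiedSubgroup_primary_eq_pow_of_split_of_not_dvd W p v hpv hs (hexc hs)
    · exact natCard_unramifiedSubgroup_primary_eq_pow_of_nonsplit W p v hpv hp2 hm hs
  · exact natCard_unramifiedSubgroup_primary_eq_pow_padicValNat_localTamagawaNumber_of_hasAdditiveReductionAt W p v hpv ha

end Places

end Summit.BirchSwinnertonDyer.BirchSwinnertonDyer.Theorems.KatoFiniteLevelCount

end
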